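import Summits.BirchSwinnertonDyer.Rank1Residual.Additive.KobayashiSignedGenerationRat
import Literature.NumberTheory.NumberFields.CyclotomicMaximalRealSubfieldDegree
import HarnessLib

/-!
# The `ℤ_p`-layer subgroups `H_n = Gal(ℚ̄_p/ℚ_{p,n})` inside the cyclotomic tower `k_n = ℚ_p(ζ_{p^{n+1}})`: `Stab(ζ_{p^{n+1}}) ≤ H_n`
# with index `p − 1`, `H_n` acts on `ζ_{p^{n+1}}` through `μ_{p−1}`, and every element of `μ_{p−1}` occurs
# (route `PrintX8VS` / `PrintX8`, support item `InputHondaSystem` = stmt-BirchSwinnertonDyer-20413, named fact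
# `Sprung2012.thm22_exists_isHondaSystem`; file 7 of the local series: the Galois bookkeeping of the `Δ`-descent
# `k_n = ℚ_p(ζ_{p^{n+1}}) ⊇ ℚ_{p,n} = k_n^{Δ}`, `Δ ≅ μ_{p−1}`, by which Sprung's Thm. 2.2 is read on the `ℤ_p`-tower)

HONEST FRAMING (desk `pub/bsd-wall/bsd-inputs`, seat `bsd-inputs-honda-p1`, D-0154 (2) INPUTS): THEOREMS ONLY — no definition, no
named fact, no instance, no `sorry`; Galois bookkeeping; closes nothing by itself; BSD is not proved by any of this.

## Setting

`p` odd, `κ : ZpExtension ℚ p` CYCLOTOMIC, `F = ℚ(ζ_p)` (any `IsCyclotomicExtension {p} ℚ F`), an embedding `ι : ℚ̄ → ℚ̄_p`,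
`Ω = ℚ̄_p = PadicAlgCl p`, `ζ_m = zeta p m`, `Stab(ζ_m) = stab p m ≤ Γ = Gal(ℚ̄_p/ℚ_p)`. The tree identifies the local subgroup of
Kobayashi's tower `Gal(ℚ̄/F·ℚ_n)` with `Stab(ζ_{n+1})` (`localSubgroupOfEmb_towerSubgroup_eq_stab_rat`). Here
`H_n := localSubgroupOfEmb (κ.layerSubgroup n) ι = Gal(ℚ̄_p/ℚ_{p,n})`, the subgroup cutting out the layer of the `ℤ_p`-TOWER
(`localLayerSubgroupOfEmb κ ι n`, whose fixed points are `localLayerPointsOfEmb κ ι W n`, the currency of `Sprung2012.IsHondaSystem`).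

* §1 `Stab(ζ_{n+1}) ≤ H_n`; `τ ∈ H_n ⇒ τ^{p−1} ∈ Stab(ζ_{n+1})` (`Γ_ℚ/Gal(ℚ̄/F)` has order `p − 1`); hence `τ ∈ H_n` acts on `ζ_{n+1}`
  by `ζ ↦ ζᶜ` with `c^{p−1} ≡ 1 (mod p^{n+1})`; conversely every such `c` occurs for some `τ ∈ H_n` (local irreducibility of
  `Φ_{p^{n+1}}`, the tree's `exists_algEquiv_apply_zeta_eq_pow`, and `κ(res τ^{p−1}) = (p−1)κ(res τ)`).
* §2 `H_n ∩ Stab(ζ_n) = Stab(ζ_{n+1})` for `n ≥ 1` (an exponent `c ≡ 1 (mod pⁿ)` with `c^{p−1} ≡ 1 (mod p^{n+1})` is `≡ 1 (mod p^{n+1})`).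
* §3 indices: `[H_n : Stab(ζ_{n+1})] = p − 1`, `[Γ : H_n] = pⁿ`, `[H_n : H_{n+1}] = p`.

References: [Sprung2012] F. Sprung, J. Number Theory 132 (2012), §2 p. 1486 (`G_n = Δ × Γ_n`, `k_n`, `ℚ_{n}`), Thm. 2.2;
[Kobayashi2003] S. Kobayashi, Invent. Math. 152 (2003), §2 p. 4, §8.4; [Washington1997] L. Washington, §13.1.
-/

set_option autoImplicit false
-- the Theorems namespace of this sub repeats the summit name by design (D-0017 nested layout)
set_option linter.dupNamespace false

noncomputable section

open scoped Classical

namespace Summit.BirchSwinnertonDyer.BirchSwinnertonDyer.Theorems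

namespace SprungHonda

open Literature.NumberTheory.EllipticCurves Literature.NumberTheory.GaloisRepresentations
  Literature.NumberTheory.EllipticCurves.Kobayashi2003 Literature.NumberTheory.EllipticCurves.ZpExtension
  Summit.BirchSwinnertonDyer.Rank1Residual.Additive Summit.BirchSwinnertonDyer.Rank1Residual.Additive.PadicCyclotomicTower

variable {p : ℕ} [hp : Fact p.Prime] {κ : ZpExtension ℚ p} (ι : AlgebraicClosure ℚ →ₐ[ℚ] AlgebraicClosure ℚ_[p])

/-! ## §1 `Stab(ζ_{n+1}) ≤ H_n`, the `(p−1)`-st power, and the action on `ζ_{n+1}` -/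

/-- **`Stab(ζ_{n+1}) ≤ H_n`**: `Gal(ℚ̄_p/ℚ_p(ζ_{p^{n+1}})) = Gal(ℚ̄_p/(F·ℚ_n)_v) ≤ Gal(ℚ̄_p/ℚ_{n,v})`.
[cite: Sprung2012, §2 p. 1486] -/
theorem stab_succ_le_localLayerSubgroup (hp2 : p ≠ 2) (hκ : κ.IsCyclotomic) (n : ℕ) :
    stab p (n + 1) ≤ localSubgroupOfEmb (κ.layerSubgroup n) ι := by
  haveI : NeZero p := ⟨hp.out.ne_zero⟩
  haveI := Literature.NumberTheory.NumberFields.isCyclotomicExtension_cyclotomicField_rat p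
  rw [← localSubgroupOfEmb_towerSubgroup_eq_stab_rat (F := CyclotomicField p ℚ) (ι := ι) κ hp2 hκ n]
  exact Subgroup.comap_mono inf_le_left

/-- **`τ ∈ H_n ⇒ τ^{p−1} ∈ Stab(ζ_{n+1})`**: `Γ_ℚ / Gal(ℚ̄/F)` has order `[F : ℚ] = p − 1`, so `(res τ)^{p−1} ∈ Gal(ℚ̄/F) ∩ κ⁻¹(pⁿℤ_p)
= Gal(ℚ̄/F·ℚ_n)`, whose local subgroup is `Stab(ζ_{n+1})`. [cite: Sprung2012, §2 p. 1486 (G_n = Δ × Γ_n)] -/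
theorem pow_sub_one_mem_stab (hp2 : p ≠ 2) (hκ : κ.IsCyclotomic) {n : ℕ} {τ : Field.absoluteGaloisGroup ℚ_[p]}
    (hτ : τ ∈ localSubgroupOfEmb (κ.layerSubgroup n) ι) : τ ^ (p - 1) ∈ stab p (n + 1) := by
  haveI : NeZero p := ⟨hp.out.ne_zero⟩
  haveI := Literature.NumberTheory.NumberFields.isCyclotomicExtension_cyclotomicField_rat p
  haveI := normal_galRange_cyclotomic p (CyclotomicField p ℚ)
  rw [← localSubgroupOfEmb_towerSubgroup_eq_stab_rat (F := CyclotomicField p ℚ) (ι := ι) κ hp2 hκ n,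
    mem_localSubgroupOfEmb_iff, map_pow, mem_towerSubgroup_iff]
  rw [mem_localSubgroupOfEmb_iff] at hτ
  refine ⟨Subgroup.pow_mem _ hτ _, ?_⟩
  rw [← index_galRange_cyclotomic p (CyclotomicField p ℚ)]
  exact Subgroup.pow_index_mem _ _

/-- Iterating an automorphism that raises `ζ` to the `c`-th power: `τᵏ • ζ = ζ^{cᵏ}`. [folklore] -/
theorem pow_smul_eq_pow_pow {ζ : PadicAlgCl p} {τ : Field.absoluteGaloisGroup ℚ_[p]} {c : ℕ} (h : τ • ζ = ζ ^ c) (k : ℕ) :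
    τ ^ k • ζ = ζ ^ c ^ k := by
  induction k with
  | zero => rw [pow_zero, one_smul, pow_zero, pow_one]
  | succ k ih => rw [pow_succ, mul_smul, h, smul_pow', ih, ← pow_mul, ← pow_succ]

/-- **The action of `H_n` on `ζ_{n+1}` factors through `μ_{p−1}`**: for `τ ∈ H_n` there is `c < p^{n+1}` with `τ • ζ_{n+1} = ζ_{n+1}ᶜ`
and `c^{p−1} ≡ 1 (mod p^{n+1})`. [cite: Sprung2012, §2 p. 1486] -/
theorem exists_smul_zeta_eq_pow_of_mem_localLayerSubgroup (hp2 : p ≠ 2) (hκ : κ.IsCyclotomic) {n : ℕ}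
    {τ : Field.absoluteGaloisGroup ℚ_[p]} (hτ : τ ∈ localSubgroupOfEmb (κ.layerSubgroup n) ι) :
    ∃ c : ℕ, c < p ^ (n + 1) ∧ τ • zeta p (n + 1) = zeta p (n + 1) ^ c ∧ c ^ (p - 1) ≡ 1 [MOD p ^ (n + 1)] := by
  obtain ⟨c, hc, hcζ⟩ := exists_apply_zeta_eq_pow p (Field.absoluteGaloisGroup.toAlgEquiv ℚ_[p] τ) (n + 1)
  have hsmul : τ • zeta p (n + 1) = zeta p (n + 1) ^ c := hcζ
  refine ⟨c, hc, hsmul, ?_⟩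
  have hfix : τ ^ (p - 1) • zeta p (n + 1) = zeta p (n + 1) := (mem_stab_iff _).mp (pow_sub_one_mem_stab ι hp2 hκ hτ)
  rw [pow_smul_eq_pow_pow hsmul] at hfix
  exact (pow_eq_pow_iff_modEq_of_isPrimitiveRoot (isPrimitiveRoot_zeta p (n + 1))
    (pow_ne_zero _ hp.out.ne_zero)).mp (hfix.trans (pow_one _).symm)

/-- `κ(res τᵏ) = k · κ(res τ)` in `ℤ_p`. [folklore] -/
theorem toAdd_kappa_resGalOfEmb_pow (τ : Field.absoluteGaloisGroup ℚ_[p]) (k : ℕ) :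
    (κ (resGalOfEmb ι (τ ^ k))).toAdd = k * (κ (resGalOfEmb ι τ)).toAdd := by
  rw [map_pow]
  change (κ.toContinuousMonoidHom (resGalOfEmb ι τ ^ k)).toAdd = _
  rw [map_pow, toAdd_pow, nsmul_eq_mul]
  rfl

/-- **From `τ^{p−1} ∈ H_n` to `τ ∈ H_n`**: `p − 1` is a unit of `ℤ_p`, so `pⁿ ∣ (p−1)κ(res τ)` gives `pⁿ ∣ κ(res τ)`. [folklore] -/
theorem mem_localLayerSubgroup_of_pow_sub_one_mem {n : ℕ} {τ : Field.absoluteGaloisGroup ℚ_[p]}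
    (h : τ ^ (p - 1) ∈ localSubgroupOfEmb (κ.layerSubgroup n) ι) : τ ∈ localSubgroupOfEmb (κ.layerSubgroup n) ι := by
  rw [mem_localSubgroupOfEmb_iff, mem_layerSubgroup] at h ⊢
  rw [toAdd_kappa_resGalOfEmb_pow] at h
  have hu : IsUnit ((p - 1 : ℕ) : ℤ_[p]) := by
    rw [PadicInt.isUnit_iff]
    have hcop : ¬ p ∣ (p - 1) := by
      intro hd
      have h1 := Nat.le_of_dvd (Nat.sub_pos_of_lt hp.out.one_lt) hd
      have h2 := hp.out.one_lt
      omega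
    rw [show ((p - 1 : ℕ) : ℤ_[p]) = ((p - 1 : ℕ) : ℤ) from by push_cast; rfl]
    by_contra hne
    exact hcop (by exact_mod_cast (PadicInt.norm_int_lt_one_iff_dvd _).mp (lt_of_le_of_ne (PadicInt.norm_le_one _) hne))
  exact (hu.dvd_mul_left).mp h

/-- **Every `(p−1)`-st root of unity mod `p^{n+1}` is realised by `H_n`**: for `c` coprime to `p` with `c^{p−1} ≡ 1 (mod p^{n+1})`
there is `τ ∈ H_n` with `τ • ζ_{n+1} = ζ_{n+1}ᶜ` (an automorphism of `ℚ̄_p` with `ζ_{n+1} ↦ ζ_{n+1}ᶜ` exists by the tree's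
`exists_algEquiv_apply_zeta_eq_pow`; its `(p−1)`-st power fixes `ζ_{n+1}`, so lies in `Stab(ζ_{n+1}) ≤ H_n`).
[cite: Sprung2012, §2 p. 1486] [cite: SerreLocalFields1979, Ch. IV §4 Prop. 17] -/
theorem exists_mem_localLayerSubgroup_smul_zeta_eq_pow (hp2 : p ≠ 2) (hκ : κ.IsCyclotomic) (n : ℕ) {c : ℕ}
    (hc : c.Coprime p) (hc1 : c ^ (p - 1) ≡ 1 [MOD p ^ (n + 1)]) :
    ∃ τ ∈ localSubgroupOfEmb (κ.layerSubgroup n) ι, τ • zeta p (n + 1) = zeta p (n + 1) ^ c := by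
  obtain ⟨σ, hσ⟩ := exists_algEquiv_apply_zeta_eq_pow p (by omega : 1 ≤ n + 1) hc
  set τ : Field.absoluteGaloisGroup ℚ_[p] := (Field.absoluteGaloisGroup.toAlgEquiv ℚ_[p]).symm σ with hτ
  have hsmul : τ • zeta p (n + 1) = zeta p (n + 1) ^ c := hσ
  refine ⟨τ, mem_localLayerSubgroup_of_pow_sub_one_mem ι (stab_succ_le_localLayerSubgroup ι hp2 hκ n ?_), hsmul⟩
  rw [mem_stab_iff, pow_smul_eq_pow_pow hsmul]
  conv_rhs => rw [← pow_one (zeta p (n + 1))]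
  exact (pow_eq_pow_iff_modEq_of_isPrimitiveRoot (isPrimitiveRoot_zeta p (n + 1)) (pow_ne_zero _ hp.out.ne_zero)).mpr hc1

/-! ## §2 `H_n ∩ Stab(ζ_n) = Stab(ζ_{n+1})` for `n ≥ 1` -/

/-- An exponent `c ≡ 1 (mod pⁿ)`, `n ≥ 1`, with `c^{p−1} ≡ 1 (mod p^{n+1})` is `≡ 1 (mod p^{n+1})`
(`c = 1 + pⁿt` gives `c^{p−1} ≡ 1 + (p−1)pⁿt (mod p^{2n})`, so `p ∣ (p−1)t`, `p ∣ t`). [folklore] -/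
theorem modEq_one_of_pow_sub_one_modEq_one {n c : ℕ} (hn : 1 ≤ n) (h1 : c ≡ 1 [MOD p ^ n])
    (h2 : c ^ (p - 1) ≡ 1 [MOD p ^ (n + 1)]) : c ≡ 1 [MOD p ^ (n + 1)] := by
  have hpz : Prime (p : ℤ) := Nat.prime_iff_prime_int.mp hp.out
  -- translate to divisibilities in `ℤ`
  rw [Nat.ModEq.comm, Nat.modEq_iff_dvd] at h1 h2 ⊢
  push_cast at h1 h2 ⊢
  obtain ⟨t, ht⟩ := h1
  -- `c = 1 + pⁿ t`
  have hc : (c : ℤ) = 1 + (p : ℤ) ^ n * t := by linear_combination ht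
  -- second-order binomial congruence
  have hsq : ((p : ℤ) ^ n * t) ^ 2 ∣ (1 + (p : ℤ) ^ n * t) ^ (p - 1) - 1 ^ (p - 1 - 1) * ((p : ℤ) ^ n * t) * ((p - 1 : ℕ) : ℤ) -
      1 ^ (p - 1) := sq_dvd_add_pow_sub_sub _ _ _
  rw [one_pow, one_pow, one_mul] at hsq
  have hpn : (p : ℤ) ^ (n + 1) ∣ ((p : ℤ) ^ n * t) ^ 2 := by
    rw [mul_pow, ← pow_mul]
    exact (pow_dvd_pow _ (by omega)).mul_right _
  have hA : (p : ℤ) ^ (n + 1) ∣ (c : ℤ) ^ (p - 1) - 1 - (p : ℤ) ^ n * t * ((p - 1 : ℕ) : ℤ) := by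
    have := hpn.trans hsq
    rwa [← hc, show (c : ℤ) ^ (p - 1) - (p : ℤ) ^ n * t * ((p - 1 : ℕ) : ℤ) - 1 =
      (c : ℤ) ^ (p - 1) - 1 - (p : ℤ) ^ n * t * ((p - 1 : ℕ) : ℤ) by ring] at this
  have hB : (p : ℤ) ^ (n + 1) ∣ (p : ℤ) ^ n * t * ((p - 1 : ℕ) : ℤ) := by
    have := dvd_sub h2 hA
    rwa [sub_sub_cancel] at this
  -- cancel `pⁿ`: `p ∣ t (p − 1)`, and `p ∤ p − 1`
  rw [pow_succ, mul_assoc] at hB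
  have hpt : (p : ℤ) ∣ t * ((p - 1 : ℕ) : ℤ) := (mul_dvd_mul_iff_left (pow_ne_zero n hpz.ne_zero)).mp hB
  have hndvd : ¬ (p : ℤ) ∣ ((p - 1 : ℕ) : ℤ) := by
    intro h
    have h' : p ∣ p - 1 := by exact_mod_cast h
    have := Nat.le_of_dvd (Nat.sub_pos_of_lt hp.out.one_lt) h'
    have h2 := hp.out.one_lt
    omega
  have ht' : (p : ℤ) ∣ t := (hpz.dvd_or_dvd hpt).resolve_right hndvd
  obtain ⟨u, rfl⟩ := ht'
  refine ⟨u, ?_⟩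
  linear_combination ht

/-- **`H_n ∩ Stab(ζ_n) = Stab(ζ_{n+1})` for `n ≥ 1`**: an element of `H_n` fixing `ζ_n = ζ_{n+1}ᵖ` fixes `ζ_{n+1}` (its exponent
`c` has `c ≡ 1 (mod pⁿ)` and `c^{p−1} ≡ 1 (mod p^{n+1})`). Consequently `H_n/Stab(ζ_{n+1}) → H_{n−1}/Stab(ζ_n)` is injective.
[cite: Sprung2012, §2 p. 1486] -/
theorem mem_stab_succ_of_mem_localLayerSubgroup_of_mem_stab (hp2 : p ≠ 2) (hκ : κ.IsCyclotomic) {n : ℕ} (hn : 1 ≤ n)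
    {τ : Field.absoluteGaloisGroup ℚ_[p]} (hτ : τ ∈ localSubgroupOfEmb (κ.layerSubgroup n) ι) (hτn : τ ∈ stab p n) :
    τ ∈ stab p (n + 1) := by
  obtain ⟨c, -, hcζ, hc1⟩ := exists_smul_zeta_eq_pow_of_mem_localLayerSubgroup ι hp2 hκ hτ
  -- `τ • ζ_n = ζ_nᶜ` (as `ζ_n = ζ_{n+1}ᵖ`), and `τ` fixes `ζ_n`: so `c ≡ 1 (mod pⁿ)`
  have hzn : zeta p n = zeta p (n + 1) ^ p := (zeta_succ_pow p n).symm
  have hτζn : τ • zeta p n = zeta p n ^ c := by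
    rw [hzn, smul_pow', hcζ, ← pow_mul, ← pow_mul, mul_comm]
  have hfixn : τ • zeta p n = zeta p n := (mem_stab_iff _).mp hτn
  have h1 : c ≡ 1 [MOD p ^ n] := by
    refine (pow_eq_pow_iff_modEq_of_isPrimitiveRoot (isPrimitiveRoot_zeta p n) (pow_ne_zero _ hp.out.ne_zero)).mp ?_
    rw [pow_one, ← hτζn, hfixn]
  have hc : c ≡ 1 [MOD p ^ (n + 1)] := modEq_one_of_pow_sub_one_modEq_one hn h1 hc1
  rw [mem_stab_iff, hcζ]
  conv_rhs => rw [← pow_one (zeta p (n + 1))]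
  exact (pow_eq_pow_iff_modEq_of_isPrimitiveRoot (isPrimitiveRoot_zeta p (n + 1)) (pow_ne_zero _ hp.out.ne_zero)).mpr hc

/-! ## §3 Indices: `[H_n : Stab(ζ_{n+1})] = p − 1`, `[Γ : H_n] = pⁿ`, `[H_n : H_{n+1}] = p`; the `Δ`-bijection -/

/-- **`[H_n : Stab(ζ_{n+1})] = p − 1` and `[Γ : H_n] = pⁿ`**: `[Γ : Stab(ζ_{n+1})] = φ(p^{n+1}) = pⁿ(p−1)`, `[Γ : H_n] ∣ pⁿ`, and
`H_n / Stab(ζ_{n+1})` has exponent dividing `p − 1`, so (Cauchy) order prime to `p`. [cite: Sprung2012, §2 p. 1486]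
[cite: Washington1997, §13.1] -/
theorem index_quotientStab_and_index_localLayerSubgroup (hp2 : p ≠ 2) (hκ : κ.IsCyclotomic) (n : ℕ) :
    ((stab p (n + 1)).subgroupOf (localSubgroupOfEmb (κ.layerSubgroup n) ι)).index = p - 1 ∧
      (localSubgroupOfEmb (κ.layerSubgroup n) ι).index = p ^ n := by
  set H := localSubgroupOfEmb (κ.layerSubgroup n) ι with hH
  haveI : (stab p (n + 1)).Normal := normal_stab (n + 1)
  have hle : stab p (n + 1) ≤ H := stab_succ_le_localLayerSubgroup ι hp2 hκ n
  have hp1 : p - 1 ≠ 0 := by have := hp.out.one_lt; omega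
  have hmul : ((stab p (n + 1)).subgroupOf H).index * H.index = (p - 1) * p ^ n := by
    rw [← Subgroup.relIndex, Subgroup.relIndex_mul_index hle, index_stab' p (n + 1),
      Nat.totient_prime_pow hp.out (Nat.succ_pos n), Nat.succ_sub_one, mul_comm]
  -- in `H_n / Stab(ζ_{n+1})` every element is killed by `p − 1`
  have hexp : ∀ q : H ⧸ (stab p (n + 1)).subgroupOf H, q ^ (p - 1) = 1 := by
    intro q
    induction q using QuotientGroup.induction_on with
    | H τ =>
      rw [← QuotientGroup.mk_pow, QuotientGroup.eq_one_iff, Subgroup.mem_subgroupOf, Subgroup.coe_pow]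
      exact pow_sub_one_mem_stab ι hp2 hκ τ.2
  have hdvd : H.index ∣ p ^ n := index_localLayerSubgroupOfEmb_dvd κ ι n
  obtain ⟨j, hj, hHj⟩ := (Nat.dvd_prime_pow hp.out).1 hdvd
  -- `p ∤ [H_n : Stab(ζ_{n+1})]`
  have hndvd : ¬ p ∣ ((stab p (n + 1)).subgroupOf H).index := by
    intro hd
    haveI : ((stab p (n + 1)).subgroupOf H).FiniteIndex := ⟨fun h0 ↦ by
      rw [h0, zero_mul] at hmul
      exact (mul_ne_zero hp1 (pow_ne_zero n hp.out.ne_zero)) hmul.symm⟩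
    haveI : Finite (H ⧸ (stab p (n + 1)).subgroupOf H) := Subgroup.finite_quotient_of_finiteIndex
    obtain ⟨x, hx⟩ := exists_prime_orderOf_dvd_card' (G := H ⧸ (stab p (n + 1)).subgroupOf H) p hd
    have h1 : orderOf x ∣ p - 1 := orderOf_dvd_of_pow_eq_one (hexp x)
    rw [hx] at h1
    have := Nat.le_of_dvd (by omega) h1
    omega
  have hcop : (p ^ n).Coprime ((stab p (n + 1)).subgroupOf H).index :=
    Nat.Coprime.pow_left n ((Nat.Prime.coprime_iff_not_dvd hp.out).2 hndvd)
  -- so `j = n`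
  have hjn : j = n := by
    have h1 : p ^ n ∣ ((stab p (n + 1)).subgroupOf H).index * p ^ j := by
      rw [← hHj, hmul]; exact dvd_mul_left _ _
    have h2 : p ^ n ∣ p ^ j := hcop.dvd_of_dvd_mul_left h1
    have := (Nat.pow_dvd_pow_iff_le_right hp.out.one_lt).1 h2
    omega
  subst hjn
  refine ⟨?_, hHj⟩
  rw [hHj] at hmul
  exact Nat.eq_of_mul_eq_mul_right (pow_pos hp.out.pos j) hmul

/-- **`[H_n : H_{n+1}] = p`** (`[Γ : H_n] = pⁿ`). [cite: Sprung2012, §2 p. 1486] [cite: Washington1997, §13.1] -/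
theorem index_localLayerSubgroup_succ_subgroupOf (hp2 : p ≠ 2) (hκ : κ.IsCyclotomic) (n : ℕ) :
    ((localSubgroupOfEmb (κ.layerSubgroup (n + 1)) ι).subgroupOf (localSubgroupOfEmb (κ.layerSubgroup n) ι)).index = p := by
  have hle : localSubgroupOfEmb (κ.layerSubgroup (n + 1)) ι ≤ localSubgroupOfEmb (κ.layerSubgroup n) ι :=
    localLayerSubgroupOfEmb_antitone κ ι (Nat.le_succ n)
  have h := Subgroup.relIndex_mul_index hle
  rw [Subgroup.relIndex, (index_quotientStab_and_index_localLayerSubgroup ι hp2 hκ n).2,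
    (index_quotientStab_and_index_localLayerSubgroup ι hp2 hκ (n + 1)).2, pow_succ'] at h
  exact Nat.eq_of_mul_eq_mul_right (pow_pos hp.out.pos n) h

/-- **The `Δ`-bijection `H_{n+1}/Stab(ζ_{n+2}) ≃ H_n/Stab(ζ_{n+1})`** induced by the inclusion `H_{n+1} ≤ H_n` (injective by
`H_{n+1} ∩ Stab(ζ_{n+1}) = Stab(ζ_{n+2})`, §2; bijective as both sides have `p − 1` elements): restriction identifies
`Gal(k_{n+1}/ℚ_{p,n+1})` with `Gal(k_n/ℚ_{p,n})` (`= Δ`). Stated for any subgroups `S₁ = Stab(ζ_{n+1})`, `S₂ = Stab(ζ_{n+2})`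
(so that it applies verbatim to the local subgroups of Kobayashi's tower). [cite: Sprung2012, §2 p. 1486 (G_{n} = Δ × Γ_n)] -/
theorem bijective_quotientStab_map (hp2 : p ≠ 2) (hκ : κ.IsCyclotomic) (n : ℕ)
    {S₁ S₂ : Subgroup (Field.absoluteGaloisGroup ℚ_[p])} (hS₁ : S₁ = stab p (n + 1)) (hS₂ : S₂ = stab p (n + 2)) :
    Function.Bijective fun q : localSubgroupOfEmb (κ.layerSubgroup (n + 1)) ι ⧸
        S₂.subgroupOf (localSubgroupOfEmb (κ.layerSubgroup (n + 1)) ι) ↦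
      (QuotientGroup.mk (s := S₁.subgroupOf (localSubgroupOfEmb (κ.layerSubgroup n) ι))
        ⟨((q.out : localSubgroupOfEmb (κ.layerSubgroup (n + 1)) ι) : Field.absoluteGaloisGroup ℚ_[p]),
          localLayerSubgroupOfEmb_antitone κ ι (Nat.le_succ n) q.out.2⟩ :
        localSubgroupOfEmb (κ.layerSubgroup n) ι ⧸ S₁.subgroupOf (localSubgroupOfEmb (κ.layerSubgroup n) ι)) := by
  subst hS₁ hS₂
  set H₁ := localSubgroupOfEmb (κ.layerSubgroup (n + 1)) ι with hH₁
  set H₀ := localSubgroupOfEmb (κ.layerSubgroup n) ι with hH₀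
  have hinj : Function.Injective fun q : H₁ ⧸ (stab p (n + 2)).subgroupOf H₁ ↦
      (QuotientGroup.mk (s := (stab p (n + 1)).subgroupOf H₀)
        ⟨((q.out : H₁) : Field.absoluteGaloisGroup ℚ_[p]), localLayerSubgroupOfEmb_antitone κ ι (Nat.le_succ n) q.out.2⟩ :
        H₀ ⧸ (stab p (n + 1)).subgroupOf H₀) := by
    intro q q' h
    have h' := h
    rw [QuotientGroup.eq, Subgroup.mem_subgroupOf, Subgroup.coe_mul, Subgroup.coe_inv] at h'
    have hmem : ((q.out : H₁) : Field.absoluteGaloisGroup ℚ_[p])⁻¹ * ((q'.out : H₁) : Field.absoluteGaloisGroup ℚ_[p]) ∈ H₁ :=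
      H₁.mul_mem (H₁.inv_mem q.out.2) q'.out.2
    have hst : ((q.out : H₁) : Field.absoluteGaloisGroup ℚ_[p])⁻¹ * ((q'.out : H₁) : Field.absoluteGaloisGroup ℚ_[p]) ∈
        stab p (n + 2) := mem_stab_succ_of_mem_localLayerSubgroup_of_mem_stab ι hp2 hκ (Nat.succ_pos n) hmem h'
    rw [← QuotientGroup.out_eq' q, ← QuotientGroup.out_eq' q', QuotientGroup.eq, Subgroup.mem_subgroupOf, Subgroup.coe_mul,
      Subgroup.coe_inv]
    exact hst
  haveI : ((stab p (n + 1)).subgroupOf H₀).FiniteIndex := ⟨by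
    rw [(index_quotientStab_and_index_localLayerSubgroup ι hp2 hκ n).1]; have := hp.out.one_lt; omega⟩
  haveI : Finite (H₀ ⧸ (stab p (n + 1)).subgroupOf H₀) := Subgroup.finite_quotient_of_finiteIndex
  refine hinj.bijective_of_nat_card_le (le_of_eq ?_)
  rw [← Subgroup.index, ← Subgroup.index, (index_quotientStab_and_index_localLayerSubgroup ι hp2 hκ n).1,
    (index_quotientStab_and_index_localLayerSubgroup ι hp2 hκ (n + 1)).1]

end SprungHonda

end Summit.BirchSwinnertonDyer.BirchSwinnertonDyer.Theorems

end
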